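import Literature.NumberTheory.NumberFields.QuadraticExtensionOddClassNumberTransfer
import HarnessLib

/-!
# Odd class numbers go UP a totally real quadratic extension with at most two ramified primes and ONE non-norm unit
# (Chevalley's ambiguous class number formula; genus theory with a unit certificate)

Topic `NumberTheory/NumberFields`; namespace `Literature.NumberTheory.NumberFields.AmbiguousClass`. Theorem-only file
(no definition, no named fact, no instance, no `sorry`), written by the prover seat `bsd-2adic-k4-w1` GEN 10 (cell `bsd-2adic`;
`--supports` stmt-BirchSwinnertonDyer-22615: the parity of `h(ℚ(P)(√2))` for the totally real cubic point fields `ℚ(P)` of K4's additive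
census — the first cyclotomic layer of `ℚ(P)` —, which the narrow-Fukuda door of the `Δ > 0` rows needs as a KERNEL input).  Companion of
`QuadraticExtensionOddClassNumberTransfer.lean` (cruxlead-19573-w2 GEN 9: the totally COMPLEX case, where `−1` is the automatic non-norm
unit); its `TODO(general form)` for a totally real base is discharged here in certificate form.

Chevalley (tree `ambiguousClassNumberFormula`, Lang, *Cyclotomic Fields I–II*, Ch. 13 §4 Lemma 4.1) for `L/K` quadratic:
`#Cl(L)^G · 2 · [E_K : E_K ∩ N_{L/K} Lˣ] = h_K · ∏_𝔭 e_𝔭 · ∏_{v ∣ ∞} e_v`.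

* `archFactor_eq_one_of_isTotallyReal` — `∏_{v ∣ ∞} e_v = 1` when `L` is totally real (no infinite place ramifies).
* `two_dvd_relIndex_unitsNorm_of_not_mem` — a unit `x ∈ E_K` that is NOT a norm from `Lˣ` makes the unit index even
  (`x² = N_{L/K} x` is a norm).
* `sub_mul_sq_of_norm_eq` / `not_mem_map_norm_of_forall_sq_sub_mul_sq_ne` — the norm form of `L = K(s)`, `s² = m ∈ K`, `s ∉ K`:
  `N_{L/K}(a + bs) = a² − m b²` and every element of `L` is `a + bs`; so «`u` is not a norm from `L`» follows from
  «`a² − m b² ≠ u` for all `a, b ∈ K`» (O'Meara 63:10) — the shape in which a dyadic or sign certificate is supplied.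
* **`odd_classNumber_of_quadratic_of_isTotallyReal_of_not_mem_norm`** — `[L : K] = 2`, `L` totally real, `∏_𝔭 e_𝔭(L/K) ∣ 4` (at most two
  finite primes of `K` ramify in `L`), `h_K` odd, and some unit of `K` is not a norm from `Lˣ` ⟹ `h_L` odd.
  Proof: the index is `2m`, so `#Cl(L)^G · 4m = h_K · ∏ e_𝔭` with `∏ e_𝔭 · k = 4`; hence `#Cl(L)^G · m · k = h_K` is odd, `#Cl(L)^G` is odd,
  and a `2`-group acting on `Cl(L)` with an odd number of fixed points forces `h_L` odd (`odd_classNumber_of_odd_card_fixed`).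
  (Genus theory: two ramified places are exactly compensated by one non-norm unit.)

The intended consumer: `K = ℚ(θ)` a totally real cubic with `h_K` odd in which `2 = 𝔭₁²𝔭₂`, `L = K(√2)` (ramified at most at `𝔭₁`,
`𝔭₂`: a prime `∌ 8` is unramified, tree `isUnramifiedAt_of_sq_eq`), and a unit `ε ≡ 3 (mod 𝔭₂³)`, which is not of the form `a² − 2b²`
(tree `DyadicUnitNotNormFromSqrtTwo`): then `h_L` is odd.

## References

* S. Lang, *Cyclotomic Fields I and II*, GTM 121 (1990), Ch. 13 §4, Lemma 4.1 and 4.2 (PDF pp. 203–204). [Lang1990]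
* G. Gras, *Class Field Theory* (2003), IV.4 (genus theory: the number of invariant classes). [Gras2003]
* O. T. O'Meara, *Introduction to Quadratic Forms* (1963), §63B, 63:10 (norms from `K(√m)`). [Omeara1963]
* K. Horie, *On CM-fields with the same maximal real subfield*, Acta Arith. 67 (1994), §1 Lemma 1 (shape of the unit index). [Horie1994]
-/

noncomputable section

open NumberField NumberField.InfinitePlace IsDedekindDomain
open scoped nonZeroDivisors

namespace Literature.NumberTheory.NumberFields.AmbiguousClass

open Literature.NumberTheory.GaloisRepresentations Literature.NumberTheory.GaloisRepresentations.Herbrand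
  Literature.NumberTheory.GaloisRepresentations.MinkowskiUnit
  Literature.NumberTheory.GaloisRepresentations.CyclicNormIndex

variable {K L : Type} [Field K] [NumberField K] [Field L] [NumberField L] [Algebra K L]

/-! ### The archimedean factor for a totally real top field -/

omit [NumberField L] in
/-- **`∏_{v ∣ ∞} e_v = 1` when `L` is totally real** (`L/K` Galois): every infinite place of `L` is real, hence unramified over `K`
(decomposition group trivial). [cite: Lang1990, Ch. 13 §4, before Lemma 4.1 ("if `v` is Archimedean, then `e(v) = 1` or `2`") (PDF p. 203)] -/
theorem archFactor_eq_one_of_isTotallyReal [IsGalois K L] [IsTotallyReal L] : ArchHerbrand.archFactor K L = 1 := by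
  classical
  unfold ArchHerbrand.archFactor
  refine Finset.prod_eq_one fun v _ => ?_
  rw [← isUnramified_iff_card_stabilizer_eq_one, isUnramified_iff]
  exact Or.inl (IsTotallyReal.isReal _)

/-! ### A non-norm unit makes the unit index even -/

/-- **The unit index of Chevalley's formula is EVEN as soon as ONE unit `x ∈ E_K` is not a norm from `Lˣ`** (`[L : K] = 2`): the
class of `x` in `E_K / (E_K ∩ N_{L/K} Lˣ)` has order exactly `2`, because `x² = N_{L/K}(x)` IS a norm (tree `pow_finrank_mem_map_norm`).
[cite: Lang1990, Ch. 13 §4, Lemma 4.1 and proof of Lemma 4.2 (`E^l ⊆` norm group) (PDF pp. 203–204)] [cite: Gras2003, IV.4] -/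
theorem two_dvd_relIndex_unitsNorm_of_not_mem [IsGalois K L] (h2 : Module.finrank K L = 2) {x : Lˣ}
    (hxE : x ∈ unitsE L ⊓ (unitsIncl K L).range) (hxN : x ∉ (⊤ : Subgroup Lˣ).map (Herbrand.norm (L ≃ₐ[K] L))) :
    2 ∣ (unitsE L ⊓ (⊤ : Subgroup Lˣ).map (Herbrand.norm (L ≃ₐ[K] L))).relIndex
        (unitsE L ⊓ (unitsIncl K L).range) := by
  set H := unitsE L ⊓ (⊤ : Subgroup Lˣ).map (Herbrand.norm (L ≃ₐ[K] L)) with hH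
  set E := unitsE L ⊓ (unitsIncl K L).range with hE
  have hxH : (⟨x, hxE⟩ : E) ∉ H.subgroupOf E := by
    rw [Subgroup.mem_subgroupOf]
    exact fun h => hxN h.2
  rw [Subgroup.relIndex, Subgroup.index]
  set q : E ⧸ H.subgroupOf E := QuotientGroup.mk ⟨x, hxE⟩ with hq
  have hq1 : q ≠ 1 := fun h => hxH ((QuotientGroup.eq_one_iff _).mp h)
  have hq2 : q ^ 2 = 1 := by
    rw [hq, ← QuotientGroup.mk_pow, QuotientGroup.eq_one_iff, Subgroup.mem_subgroupOf]
    refine ⟨(unitsE L).pow_mem hxE.1 2, ?_⟩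
    have h := pow_finrank_mem_map_norm (K := K) (L := L) hxE.2
    rw [h2] at h
    exact h
  have hord : orderOf q = 2 := orderOf_eq_prime hq2 hq1
  rw [← hord]
  exact orderOf_dvd_natCard q

/-! ### The norm form of a quadratic extension `L = K(s)`, `s² = m` -/

/-- The Galois group of a quadratic extension: an element `σ ≠ 1`, every element is `1` or `σ`, and hence every element lies in
`⟨σ⟩`. [cite: Lang1990, Ch. 13 §4 (cyclic extensions) (PDF p. 203)] -/
theorem exists_algEquiv_ne_one_of_finrank_eq_two [IsGalois K L] (h2 : Module.finrank K L = 2) :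
    ∃ σ : L ≃ₐ[K] L, σ ≠ 1 ∧ (∀ f : L ≃ₐ[K] L, f = 1 ∨ f = σ) ∧ ∀ τ : L ≃ₐ[K] L, τ ∈ Subgroup.zpowers σ := by
  classical
  have hcard : Fintype.card (L ≃ₐ[K] L) = 2 := by rw [← Nat.card_eq_fintype_card, IsGalois.card_aut_eq_finrank, h2]
  haveI : Nontrivial (L ≃ₐ[K] L) := Fintype.one_lt_card_iff_nontrivial.mp (by rw [hcard]; norm_num)
  obtain ⟨σ, hσ1⟩ := exists_ne (1 : L ≃ₐ[K] L)
  have hall : ∀ f : L ≃ₐ[K] L, f = 1 ∨ f = σ := by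
    intro f
    by_contra hf
    push Not at hf
    have h3 : ({1, σ, f} : Finset (L ≃ₐ[K] L)).card = 3 := by
      rw [Finset.card_insert_of_notMem, Finset.card_pair hf.2.symm]
      simp only [Finset.mem_insert, Finset.mem_singleton, not_or]
      exact ⟨hσ1.symm, hf.1.symm⟩
    have := Finset.card_le_univ ({1, σ, f} : Finset (L ≃ₐ[K] L))
    rw [h3, hcard] at this
    omega
  refine ⟨σ, hσ1, hall, fun τ => ?_⟩
  rcases hall τ with h | h
  · rw [h]; exact Subgroup.one_mem _
  · rw [h]; exact Subgroup.mem_zpowers σ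

/-- **Every `y ∈ L` with `N_{L/K}(y) = u` is `a + bs` with `a² − m b² = u`** (`L/K` quadratic, `s ∈ L ∖ K`, `s² = m`): the non-trivial
automorphism `σ` has `σ s = −s`, `a = (y + σy)/2` and `b = (y − σy)/(2s)` are `σ`-fixed, hence in `K`, and `N(y) = y · σ y = a² − m b²`.
[cite: Omeara1963, §63B (63:10)] [cite: Lang1990, Ch. 13 §4 (PDF p. 203)] -/
theorem exists_sq_sub_mul_sq_eq_of_norm_eq [IsGalois K L] (h2 : Module.finrank K L = 2) {s : L} {m : K}
    (hs : s ^ 2 = algebraMap K L m) (hsK : s ∉ Set.range (algebraMap K L)) (y : L) :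
    ∃ a b : K, y = algebraMap K L a + algebraMap K L b * s ∧ Algebra.norm K y = a ^ 2 - m * b ^ 2 := by
  classical
  obtain ⟨σ, hσ1, hall, -⟩ := exists_algEquiv_ne_one_of_finrank_eq_two (K := K) (L := L) h2
  have hfix : ∀ z : L, σ z = z → z ∈ Set.range (algebraMap K L) := by
    intro z hz
    refine (IsGalois.mem_range_algebraMap_iff_fixed z).mpr fun f => ?_
    rcases hall f with rfl | rfl
    · rfl
    · exact hz
  have hs0 : s ≠ 0 := by
    rintro rfl
    exact hsK ⟨0, by simp⟩
  -- `σ s = −s`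
  have hσs : σ s = -s := by
    have hsq : (σ s) ^ 2 = s ^ 2 := by rw [← map_pow, hs, AlgEquiv.commutes]
    rcases sq_eq_sq_iff_eq_or_eq_neg.mp hsq with h | h
    · exact absurd (hfix s h) hsK
    · exact h
  -- `a = (y + σ y)/2`, `b = (y - σ y)/(2 s)` lie in `K`
  obtain ⟨a, ha⟩ := hfix ((y + σ y) / 2) (by
    rw [map_div₀, map_add, map_ofNat, add_comm]
    congr 1
    rcases hall (σ * σ) with h | h
    · have : σ (σ y) = y := by rw [← AlgEquiv.mul_apply, h, AlgEquiv.one_apply]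
      rw [this]
    · exact absurd (mul_eq_left.mp h) hσ1)
  obtain ⟨b, hb⟩ := hfix ((y - σ y) / (2 * s)) (by
    rw [map_div₀, map_sub, map_mul, map_ofNat, hσs]
    rcases hall (σ * σ) with h | h
    · have : σ (σ y) = y := by rw [← AlgEquiv.mul_apply, h, AlgEquiv.one_apply]
      rw [this]; field_simp; ring
    · exact absurd (mul_eq_left.mp h) hσ1)
  have hy : y = algebraMap K L a + algebraMap K L b * s := by
    rw [ha, hb]; field_simp; ring
  refine ⟨a, b, hy, ?_⟩
  apply (algebraMap K L).injective
  rw [Algebra.norm_eq_prod_automorphisms]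
  have huniv : (Finset.univ : Finset (L ≃ₐ[K] L)) = {1, σ} := by
    ext f
    simp only [Finset.mem_univ, Finset.mem_insert, Finset.mem_singleton, true_iff]
    exact hall f
  rw [huniv, Finset.prod_pair hσ1.symm, AlgEquiv.one_apply]
  conv_lhs => rw [hy]
  rw [map_add, map_mul, AlgEquiv.commutes, AlgEquiv.commutes, hσs, map_sub, map_mul, map_pow, map_pow, ← hs]
  ring

/-- **«`u` is not a norm from `L`» from «`a² − m b² ≠ u` for all `a, b ∈ K`»** (`L = K(s)`, `s² = m`, `s ∉ K`, `[L:K] = 2`), in the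
currency of Chevalley's formula (`N_G(Lˣ) ⊆ Lˣ`, `u ∈ Kˣ ⊆ Lˣ`). [cite: Omeara1963, §63B (63:10)] [cite: Lang1990, Ch. 13 §4, Lemma 4.1 (PDF p. 203)] -/
theorem not_mem_map_norm_of_forall_sq_sub_mul_sq_ne [IsGalois K L] (h2 : Module.finrank K L = 2) {s : L} {m : K}
    (hs : s ^ 2 = algebraMap K L m) (hsK : s ∉ Set.range (algebraMap K L)) (u : Kˣ)
    (hne : ∀ a b : K, a ^ 2 - m * b ^ 2 ≠ (u : K)) :
    unitsIncl K L u ∉ (⊤ : Subgroup Lˣ).map (Herbrand.norm (L ≃ₐ[K] L)) := by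
  rintro ⟨y, -, hy⟩
  obtain ⟨σ, -, -, hσ⟩ := exists_algEquiv_ne_one_of_finrank_eq_two (K := K) (L := L) h2
  have h1 : algebraMap K L (Algebra.norm K (y : L)) = algebraMap K L (u : K) := by
    rw [← coe_herbrandNorm_eq_algebraMap_norm hσ, hy, coe_unitsIncl]
  have h3 := (algebraMap K L).injective h1
  obtain ⟨a, b, -, hN⟩ := exists_sq_sub_mul_sq_eq_of_norm_eq h2 hs hsK (y : L)
  exact hne a b (by rw [← hN, h3])

/-! ### The parity transfer -/

/-- **Odd class numbers go up a totally real quadratic extension with at most two ramified finite primes and a non-norm unit.**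
`L/K` quadratic (`[L : K] = 2`, Galois), `L` totally real, `∏_𝔭 e_𝔭(L/K) ∣ 4` (at most two finite primes of `K` ramify, each with
`e = 2`), `h_K` odd, and some `x ∈ E_K = 𝓞_Lˣ ∩ Kˣ` is not in `N_{L/K} Lˣ` ⟹ `h_L` odd.  Chevalley: `#Cl(L)^G · 2 · [E_K : E_K ∩ N] = h_K · ∏ e_𝔭 · 1`;
the index is `2m` (`two_dvd_relIndex_unitsNorm_of_not_mem`) and `∏ e_𝔭 · k = 4`, so `#Cl(L)^G · m · k = h_K` is odd, `#Cl(L)^G` is odd, and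
`odd_classNumber_of_odd_card_fixed` concludes. [cite: Lang1990, Ch. 13 §4, Lemma 4.1 (PDF pp. 203–204)] [cite: Gras2003, IV.4 (genus theory)]
[cite: Horie1994, §1 Lemma 1] -/
theorem odd_classNumber_of_quadratic_of_isTotallyReal_of_not_mem_norm [IsGalois K L] [IsTotallyReal L]
    (h2 : Module.finrank K L = 2) (hram : (∏ᶠ v : HeightOneSpectrum (𝓞 K), v.asIdeal.ramificationIdxIn (𝓞 L)) ∣ 4)
    {x : Lˣ} (hxE : x ∈ unitsE L ⊓ (unitsIncl K L).range) (hxN : x ∉ (⊤ : Subgroup Lˣ).map (Herbrand.norm (L ≃ₐ[K] L)))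
    (hK : Odd (classNumber K)) : Odd (classNumber L) := by
  classical
  obtain ⟨σ, -, -, hσ⟩ := exists_algEquiv_ne_one_of_finrank_eq_two (K := K) (L := L) h2
  -- Chevalley
  have hChev := ambiguousClassNumberFormula hσ
  rw [h2, archFactor_eq_one_of_isTotallyReal, mul_one] at hChev
  obtain ⟨m, hm⟩ := two_dvd_relIndex_unitsNorm_of_not_mem h2 hxE hxN
  obtain ⟨k, hk⟩ := hram
  rw [hm] at hChev
  -- `#Cl(L)^G · m · k = h_K`
  have hA : Nat.card {c : ClassGroup (𝓞 L) // ∀ τ : L ≃ₐ[K] L, ClassGroup.mulEquiv (intAut τ) c = c} * m * k =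
      classNumber K := by
    have h4 : Nat.card {c : ClassGroup (𝓞 L) // ∀ τ : L ≃ₐ[K] L, ClassGroup.mulEquiv (intAut τ) c = c} * m * k * 4 =
        classNumber K * 4 := by
      calc _ = Nat.card {c : ClassGroup (𝓞 L) // ∀ τ : L ≃ₐ[K] L, ClassGroup.mulEquiv (intAut τ) c = c} * 2 * (2 * m) * k := by ring
        _ = classNumber K * (∏ᶠ v : HeightOneSpectrum (𝓞 K), v.asIdeal.ramificationIdxIn (𝓞 L)) * k := by rw [hChev]
        _ = classNumber K * 4 := by rw [mul_assoc, ← hk]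
    exact Nat.eq_of_mul_eq_mul_right (by norm_num) h4
  have hAodd : Odd (Nat.card {c : ClassGroup (𝓞 L) // ∀ τ : L ≃ₐ[K] L, ClassGroup.mulEquiv (intAut τ) c = c}) := by
    rw [← hA, mul_assoc] at hK
    exact (Nat.odd_mul.mp hK).1
  -- `σ² = 1`
  have hσ2 : σ ^ 2 ^ 1 = 1 := by
    have hc : Fintype.card (L ≃ₐ[K] L) = 2 := by
      rw [← Nat.card_eq_fintype_card, IsGalois.card_aut_eq_finrank, h2]
    rw [pow_one, ← hc]
    exact pow_card_eq_one
  exact odd_classNumber_of_odd_card_fixed hσ hσ2 hAodd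

/-- **The same with the non-norm unit given as a unit of `𝓞 K` and the non-norm property in norm-form currency**: `L = K(s)` totally real,
`s² = m ∈ K`, `s ∉ K`, `[L : K] = 2`, `∏_𝔭 e_𝔭(L/K) ∣ 4`, `h_K` odd, and a unit `ε` of `𝓞 K` with `a² − m b² ≠ ε` for all `a, b ∈ K` ⟹ `h_L` odd.
[cite: Lang1990, Ch. 13 §4, Lemma 4.1 (PDF pp. 203–204)] [cite: Omeara1963, §63B (63:10)] [cite: Gras2003, IV.4 (genus theory)] -/
theorem odd_classNumber_of_quadratic_of_isTotallyReal_of_forall_sq_sub_mul_sq_ne [IsGalois K L] [IsTotallyReal L]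
    (h2 : Module.finrank K L = 2) (hram : (∏ᶠ v : HeightOneSpectrum (𝓞 K), v.asIdeal.ramificationIdxIn (𝓞 L)) ∣ 4)
    {s : L} {m : K} (hs : s ^ 2 = algebraMap K L m) (hsK : s ∉ Set.range (algebraMap K L))
    (ε : (𝓞 K)ˣ) (hne : ∀ a b : K, a ^ 2 - m * b ^ 2 ≠ ((ε : 𝓞 K) : K)) (hK : Odd (classNumber K)) :
    Odd (classNumber L) := by
  set u : Kˣ := Units.map (algebraMap (𝓞 K) K : 𝓞 K →* K) ε with hu
  have huval : (u : K) = ((ε : 𝓞 K) : K) := rfl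
  have hxE : unitsIncl K L u ∈ unitsE L ⊓ (unitsIncl K L).range := by
    refine ⟨mem_unitsE_iff.mpr ⟨Units.map (algebraMap (𝓞 K) (𝓞 L) : 𝓞 K →* 𝓞 L) ε, Units.ext ?_⟩, ⟨u, rfl⟩⟩
    simp only [Units.coe_map, MonoidHom.coe_coe, huval]
    exact (IsScalarTower.algebraMap_apply (𝓞 K) (𝓞 L) L _).symm.trans (IsScalarTower.algebraMap_apply (𝓞 K) K L _)
  have hxN := not_mem_map_norm_of_forall_sq_sub_mul_sq_ne h2 hs hsK u (by rw [huval]; exact hne)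
  exact odd_classNumber_of_quadratic_of_isTotallyReal_of_not_mem_norm h2 hram hxE hxN hK

end Literature.NumberTheory.NumberFields.AmbiguousClass

end
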